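import Summits.NavierStokesRegularity.NavierStokesRegularity.Theorems.ExtremiserTransienceNearExtremalTransienceCanonicalForm
import Summits.NavierStokesRegularity.NavierStokesRegularity.Theorems.ExtremiserTransienceNearExtremalTransienceSharpConstant
import HarnessLib

/-!
# Route `ExtremiserTransience`, crux `NearExtremalTransience` (stmt-NavierStokesRegularity-21883):
# SHARP NORMAL FORM — one number `κ⋆`, one function `R(t)`, onset zero

`--supports stmt-NavierStokesRegularity-21883`. Author: prover seat `ns-et-p1` (g2), on top of
`…SharpConstant` (κ⋆ := sInf of the universal depletion constants is itself universal) and the g0 files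
`…Canonical`, `…CanonicalForm`.

* `nearExtremalTransience_iff_sharp` — **the crux is its instance at the single constant `κ⋆`**: `∃ θ ∈ [0,1)`
  such that every Type-I singular classical Leray–Hopf rapidly-decaying-datum flow carries a measurable flow-wise
  coefficient `k ∈ [0,1]` with `∫_{t₁}^t k²/(T−τ) ≤ (θκ⋆)² log((T−t₁)/(T−t)) + B` (the conclusion is monotone
  in `κ`, and `κ⋆ ∈ V` is the binding instance, `DepletionLadder.sharpDepletion_is_universal`). So no improvement
  of a universal CONSTANT can prove the crux: it asserts log-mean depletion strictly below the sharp static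
  constant `κ⋆` along Type-I singular flows.
* `nearExtremalTransience_iff_sharp_onsetZero` — **sharp canonical form**: the crux holds iff `∃ θ ∈ [0,1)` such
  that along every such flow EVERY minimal measurable coefficient `k₀` (the stretching efficiency
  `R(t) = |∫⟪ω,Du ω⟫|/(sup|u(t)|·‖ω(t)‖₂·‖∇ω(t)‖₂)`; it exists, `DepletionLadder.exists_canonical_coefficient`)
  satisfies, for some `B`, `∫_0^t k₀²/(T−τ) ≤ (θκ⋆)² log(T/(T−t)) + B` for all `t ∈ [0,T)` — no onset, no
  choice of coefficient, no choice of constant: the crux is ONE inequality about the log-time quadratic mean of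
  `R(t)` against ONE number `θκ⋆ < κ⋆`. Equivalently (informal reading, since `θ < 1` is an open condition):
  `sup` over Type-I singular flows of `limsup_{t↑T} (log(T/(T−t)))⁻¹ ∫_0^t R²/(T−τ) dτ` is `< κ⋆²`.

WHAT THIS IS NOT: no `θ < 1` is proved; the crux, the route and the summit stay open; Navier–Stokes regularity
is NOT proved by anything here. [folklore]
-/

noncomputable section

open Set Filter Topology MeasureTheory
open scoped InnerProductSpace RealInnerProductSpace ENNReal NNReal ContDiff
open Literature.Analysis.FluidPDE

namespace Summit.NavierStokesRegularity.NavierStokesRegularity.Theorems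

-- the problem directory repeats the summit name (`NavierStokesRegularity/NavierStokesRegularity`)
set_option linter.dupNamespace false

open DepletionLadder

/-- **THE CRUX IS ITS INSTANCE AT THE SHARP CONSTANT.** `NearExtremalTransience` (stmt-NavierStokesRegularity-21883:
`∃ θ ∈ [0,1)` such that for EVERY universal depletion constant `κ` every Type-I singular classical Leray–Hopf
rapidly-decaying-datum flow has a measurable flow-wise coefficient with log-time quadratic mean `≤ (θκ)²`) holds
iff the same is true at the single constant `κ⋆ = sInf V` (`→`: `κ⋆` is universal,
`sharpDepletion_is_universal`; `←`: `κ⋆ ≤ κ` for universal `κ`, `sharpDepletion_le`, and the bound is monotone in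
`κ` because `θ, κ⋆ ≥ 0` and `log((T−t₁)/(T−t)) ≥ 0`). Consequently no improvement of a universal CONSTANT can
prove the crux: it asserts log-mean depletion strictly below the sharp static constant. [folklore] -/
theorem nearExtremalTransience_iff_sharp :
    Summit.NavierStokesRegularity.NavierStokesRegularity.Theses.ExtremiserTransience.NearExtremalTransience ↔
    (∃ θ : ℝ, 0 ≤ θ ∧ θ < 1 ∧ ∀ (C ν T : ℝ), 0 < C → 0 < ν → 0 < T → ∀ (u : ℝ → EuclideanSpace ℝ (Fin 3) → EuclideanSpace ℝ (Fin 3)) (p : ℝ → EuclideanSpace ℝ (Fin 3) → ℝ), Literature.Analysis.FluidPDE.IsClassicalNSSolutionOn (Set.Ico 0 T) ν 0 u p → Literature.Analysis.FluidPDE.IsLerayHopfOn T ν 0 (u 0) u → Literature.Analysis.FluidPDE.HasRapidSpatialDecay (u 0) → (∀ᶠ t in 𝓝[<] T, ∀ x, Real.sqrt (T - t) * ‖u t x‖ ≤ C * Real.sqrt ν) → ¬ Literature.Analysis.FluidPDE.HasSmoothExtensionPast ν 0 u T → ∃ t₁ ∈ Set.Ico 0 T, ∃ (k : ℝ → ℝ)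 (B : ℝ), Measurable k ∧ (∀ τ, 0 ≤ k τ ∧ k τ ≤ 1) ∧ (∀ t ∈ Set.Ico t₁ T, ∀ M : ℝ, (∀ x, ‖u t x‖ ≤ M) → |∫ x, ⟪Literature.Analysis.FluidPDE.curl (u t) x, fderiv ℝ (u t) x (Literature.Analysis.FluidPDE.curl (u t) x)⟫_ℝ| ≤ k t * M * Real.sqrt (∫ x, ‖Literature.Analysis.FluidPDE.curl (u t) x‖ ^ 2) * Real.sqrt (∫ x, Literature.Analysis.FluidPDE.frobeniusNormSq (fderiv ℝ (Literature.Analysis.FluidPDE.curl (u t)) x))) ∧ (∀ t ∈ Set.Ico t₁ T, ∫ τ in t₁..t, k τ ^ 2 / (T - τ) ≤ (θ * (sInf {κ : ℝ | (∀ (v : EuclideanSpace ℝ (Fin 3) → EuclideanSpace ℝ (Fin 3)) (M B : ℝ), ContDiff ℝ (⊤ : ℕ∞) v → Literature.Analysis.FluidPDE.VectorCalculus.IsDivFree v → (∀ x, ‖v x‖ ≤ M) → (∀ x, ‖fderiv ℝ v x‖ ≤ B) → (∫⁻ x, ‖iteratedFDeriv ℝ 0 v x‖ₑ ^ 2 <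 ⊤) → (∫⁻ x, ‖iteratedFDeriv ℝ 1 v x‖ₑ ^ 2 < ⊤) → (∫⁻ x, ‖iteratedFDeriv ℝ 2 v x‖ₑ ^ 2 < ⊤) → |∫ x, ⟪Literature.Analysis.FluidPDE.curl v x, fderiv ℝ v x (Literature.Analysis.FluidPDE.curl v x)⟫_ℝ| ≤ κ * M * Real.sqrt (∫ x, ‖Literature.Analysis.FluidPDE.curl v x‖ ^ 2) * Real.sqrt (∫ x, Literature.Analysis.FluidPDE.frobeniusNormSq (fderiv ℝ (Literature.Analysis.FluidPDE.curl v) x)))})) ^ 2 * Real.log ((T - t₁) / (T - t)) + B)) := by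
  constructor
  · rintro ⟨θ, hθ0, hθ1, H⟩
    exact ⟨θ, hθ0, hθ1, H _ sharpDepletion_is_universal⟩
  · rintro ⟨θ, hθ0, hθ1, H⟩
    refine ⟨θ, hθ0, hθ1, fun κ hκ C ν T hC hν hT u p hsol hLH hdec hrate hext => ?_⟩
    obtain ⟨t₁, ht₁, k, B, hkm, hk01, hflow, hmean⟩ := H C ν T hC hν hT u p hsol hLH hdec hrate hext
    refine ⟨t₁, ht₁, k, B, hkm, hk01, hflow, fun t ht => (hmean t ht).trans ?_⟩
    have hs0 : 0 ≤ sInf {κ : ℝ | (∀ (v : EuclideanSpace ℝ (Fin 3) → EuclideanSpace ℝ (Fin 3)) (M B : ℝ), ContDiff ℝ (⊤ : ℕ∞) v → Literature.Analysis.FluidPDE.VectorCalculus.IsDivFree v → (∀ x, ‖v x‖ ≤ M) → (∀ x, ‖fderiv ℝ v x‖ ≤ B) → (∫⁻ x, ‖iteratedFDeriv ℝ 0 v x‖ₑ ^ 2 < ⊤) → (∫⁻ x, ‖iteratedFDeriv ℝ 1 v x‖ₑ ^ 2 < ⊤) → (∫⁻ x, ‖iteratedFDeriv ℝ 2 v x‖ₑ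 ^ 2 < ⊤) → |∫ x, ⟪Literature.Analysis.FluidPDE.curl v x, fderiv ℝ v x (Literature.Analysis.FluidPDE.curl v x)⟫_ℝ| ≤ κ * M * Real.sqrt (∫ x, ‖Literature.Analysis.FluidPDE.curl v x‖ ^ 2) * Real.sqrt (∫ x, Literature.Analysis.FluidPDE.frobeniusNormSq (fderiv ℝ (Literature.Analysis.FluidPDE.curl v) x)))} := le_of_lt (lt_trans (by norm_num) sharpDepletion_gt)
    have hle : sInf {κ : ℝ | (∀ (v : EuclideanSpace ℝ (Fin 3) → EuclideanSpace ℝ (Fin 3)) (M B : ℝ), ContDiff ℝ (⊤ : ℕ∞) v → Literature.Analysis.FluidPDE.VectorCalculus.IsDivFree v → (∀ x, ‖v x‖ ≤ M) → (∀ x, ‖fderiv ℝ v x‖ ≤ B) → (∫⁻ x, ‖iteratedFDeriv ℝ 0 v x‖ₑ ^ 2 < ⊤) → (∫⁻ x, ‖iteratedFDeriv ℝ 1 v x‖ₑ ^ 2 < ⊤) → (∫⁻ x, ‖iteratedFDeriv ℝ 2 v x‖ₑ ^ 2 < ⊤) → |∫ x, ⟪Literature.Analysis.FluidPDE.curl v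 x, fderiv ℝ v x (Literature.Analysis.FluidPDE.curl v x)⟫_ℝ| ≤ κ * M * Real.sqrt (∫ x, ‖Literature.Analysis.FluidPDE.curl v x‖ ^ 2) * Real.sqrt (∫ x, Literature.Analysis.FluidPDE.frobeniusNormSq (fderiv ℝ (Literature.Analysis.FluidPDE.curl v) x)))} ≤ κ := sharpDepletion_le hκ
    have hlog : 0 ≤ Real.log ((T - t₁) / (T - t)) :=
      Real.log_nonneg ((one_le_div (sub_pos.2 ht.2)).2 (by linarith [ht.1]))
    have hsq : (θ * sInf {κ : ℝ | (∀ (v : EuclideanSpace ℝ (Fin 3) → EuclideanSpace ℝ (Fin 3)) (M B : ℝ), ContDiff ℝ (⊤ : ℕ∞) v → Literature.Analysis.FluidPDE.VectorCalculus.IsDivFree v → (∀ x, ‖v x‖ ≤ M) → (∀ x, ‖fderiv ℝ v x‖ ≤ B) → (∫⁻ x, ‖iteratedFDeriv ℝ 0 v x‖ₑ ^ 2 < ⊤) → (∫⁻ x, ‖iteratedFDeriv ℝ 1 v x‖ₑ ^ 2 < ⊤) → (∫⁻ x, ‖iteratedFDeriv ℝ 2 v x‖ₑ ^ 2 < ⊤)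 → |∫ x, ⟪Literature.Analysis.FluidPDE.curl v x, fderiv ℝ v x (Literature.Analysis.FluidPDE.curl v x)⟫_ℝ| ≤ κ * M * Real.sqrt (∫ x, ‖Literature.Analysis.FluidPDE.curl v x‖ ^ 2) * Real.sqrt (∫ x, Literature.Analysis.FluidPDE.frobeniusNormSq (fderiv ℝ (Literature.Analysis.FluidPDE.curl v) x)))}) ^ 2 ≤ (θ * κ) ^ 2 :=
      pow_le_pow_left₀ (mul_nonneg hθ0 hs0) (mul_le_mul_of_nonneg_left hle hθ0) 2
    linarith [mul_le_mul_of_nonneg_right hsq hlog]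

/-- **SHARP CANONICAL FORM OF THE CRUX (onset zero, canonical coefficient, sharp constant).**
`NearExtremalTransience` holds iff there is `θ ∈ [0,1)` such that for every Type-I singular classical Leray–Hopf
rapidly-decaying-datum flow `u` on `[0,T)` and EVERY measurable `k₀ : ℝ → [0,1]` satisfying the flow-wise clause on
`[0,T)` and minimal there (the stretching efficiency `R(t)`; it exists, `DepletionLadder.exists_canonical_coefficient`)
there is `B` with `∫_0^t k₀²/(T−τ) ≤ (θκ⋆)² log(T/(T−t)) + B` for all `t ∈ [0,T)`. (`→`:
`nearExtremalTransience_iff_canonical` at `κ = κ⋆`, then `logMean_bound_from_zero`; `←`: take `t₁ = 0`, `k = k₀`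
the canonical coefficient, and enlarge `(θκ⋆)²` to `(θκ)²`.) In words: the crux says exactly that the log-time
quadratic mean of the stretching efficiency of Type-I singular flows is asymptotically at most `θκ⋆` for ONE
universal `θ < 1`. [folklore] -/
theorem nearExtremalTransience_iff_sharp_onsetZero :
    Summit.NavierStokesRegularity.NavierStokesRegularity.Theses.ExtremiserTransience.NearExtremalTransience ↔
    (∃ θ : ℝ, 0 ≤ θ ∧ θ < 1 ∧ ∀ (C ν T : ℝ), 0 < C → 0 < ν → 0 < T → ∀ (u : ℝ → EuclideanSpace ℝ (Fin 3) → EuclideanSpace ℝ (Fin 3)) (p : ℝ → EuclideanSpace ℝ (Fin 3) → ℝ), Literature.Analysis.FluidPDE.IsClassicalNSSolutionOn (Set.Ico 0 T) ν 0 u p → Literature.Analysis.FluidPDE.IsLerayHopfOn T ν 0 (u 0) u → Literature.Analysis.FluidPDE.HasRapidSpatialDecay (u 0) → (∀ᶠ t in 𝓝[<] T, ∀ x, Real.sqrt (T - t) * ‖u t x‖ ≤ C * Real.sqrt ν) → ¬ Literature.Analysis.FluidPDE.HasSmoothExtensionPast ν 0 u T → ∀ k₀ : ℝ → ℝ, Measurable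 k₀ → (∀ τ, 0 ≤ k₀ τ ∧ k₀ τ ≤ 1) → (∀ t ∈ Set.Ico 0 T, ∀ M : ℝ, (∀ x, ‖u t x‖ ≤ M) → |∫ x, ⟪Literature.Analysis.FluidPDE.curl (u t) x, fderiv ℝ (u t) x (Literature.Analysis.FluidPDE.curl (u t) x)⟫_ℝ| ≤ k₀ t * M * Real.sqrt (∫ x, ‖Literature.Analysis.FluidPDE.curl (u t) x‖ ^ 2) * Real.sqrt (∫ x, Literature.Analysis.FluidPDE.frobeniusNormSq (fderiv ℝ (Literature.Analysis.FluidPDE.curl (u t)) x))) → (∀ t ∈ Set.Ico 0 T, ∀ c : ℝ, 0 ≤ c → (∀ M : ℝ, (∀ x, ‖u t x‖ ≤ M) → |∫ x, ⟪Literature.Analysis.FluidPDE.curl (u t) x, fderiv ℝ (u t) x (Literature.Analysis.FluidPDE.curl (u t) x)⟫_ℝ| ≤ c * M * Real.sqrt (∫ x, ‖Literature.Analysis.FluidPDE.curl (u t) x‖ ^ 2) * Real.sqrt (∫ x, Literature.Analysis.FluidPDE.frobeniusNormSq (fderiv ℝ (Literature.Analysis.FluidPDE.curl (u t)) x))) →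 k₀ t ≤ c) → ∃ B : ℝ, ∀ t ∈ Set.Ico 0 T, ∫ τ in (0 : ℝ)..t, k₀ τ ^ 2 / (T - τ) ≤ (θ * (sInf {κ : ℝ | (∀ (v : EuclideanSpace ℝ (Fin 3) → EuclideanSpace ℝ (Fin 3)) (M B : ℝ), ContDiff ℝ (⊤ : ℕ∞) v → Literature.Analysis.FluidPDE.VectorCalculus.IsDivFree v → (∀ x, ‖v x‖ ≤ M) → (∀ x, ‖fderiv ℝ v x‖ ≤ B) → (∫⁻ x, ‖iteratedFDeriv ℝ 0 v x‖ₑ ^ 2 < ⊤) → (∫⁻ x, ‖iteratedFDeriv ℝ 1 v x‖ₑ ^ 2 < ⊤) → (∫⁻ x, ‖iteratedFDeriv ℝ 2 v x‖ₑ ^ 2 < ⊤) → |∫ x, ⟪Literature.Analysis.FluidPDE.curl v x, fderiv ℝ v x (Literature.Analysis.FluidPDE.curl v x)⟫_ℝ| ≤ κ * M * Real.sqrt (∫ x, ‖Literature.Analysis.FluidPDE.curl v x‖ ^ 2) * Real.sqrt (∫ x, Literature.Analysis.FluidPDE.frobeniusNormSq (fderiv ℝ (Literature.Analysis.FluidPDE.curl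 v) x)))})) ^ 2 * Real.log (T / (T - t)) + B) := by
  constructor
  · intro hNET
    obtain ⟨θ, hθ0, hθ1, H⟩ := nearExtremalTransience_iff_canonical.1 hNET
    refine ⟨θ, hθ0, hθ1, fun C ν T hC hν hT u p hsol hLH hdec hrate hext k₀ hk₀m hk₀01 hcl hmin => ?_⟩
    obtain ⟨t₁, ht₁, B, hmean⟩ :=
      H _ sharpDepletion_is_universal C ν T hC hν hT u p hsol hLH hdec hrate hext k₀ hk₀m hk₀01 hcl hmin
    exact logMean_bound_from_zero hk₀m hk₀01 ht₁ (sq_nonneg _) hmean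
  · rintro ⟨θ, hθ0, hθ1, H⟩
    refine ⟨θ, hθ0, hθ1, fun κ hκ C ν T hC hν hT u p hsol hLH hdec hrate hext => ?_⟩
    obtain ⟨k₀, hk₀m, hk₀01, hcl, hmin⟩ := exists_canonical_coefficient hν hT hsol hLH hdec
    obtain ⟨B, hB⟩ := H C ν T hC hν hT u p hsol hLH hdec hrate hext k₀ hk₀m hk₀01 hcl hmin
    refine ⟨0, ⟨le_rfl, hT⟩, k₀, B, hk₀m, hk₀01, hcl, fun t ht => ?_⟩
    rw [sub_zero]
    refine (hB t ht).trans ?_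
    have hs0 : 0 ≤ sInf {κ : ℝ | (∀ (v : EuclideanSpace ℝ (Fin 3) → EuclideanSpace ℝ (Fin 3)) (M B : ℝ), ContDiff ℝ (⊤ : ℕ∞) v → Literature.Analysis.FluidPDE.VectorCalculus.IsDivFree v → (∀ x, ‖v x‖ ≤ M) → (∀ x, ‖fderiv ℝ v x‖ ≤ B) → (∫⁻ x, ‖iteratedFDeriv ℝ 0 v x‖ₑ ^ 2 < ⊤) → (∫⁻ x, ‖iteratedFDeriv ℝ 1 v x‖ₑ ^ 2 < ⊤) → (∫⁻ x, ‖iteratedFDeriv ℝ 2 v x‖ₑ ^ 2 < ⊤) → |∫ x, ⟪Literature.Analysis.FluidPDE.curl v x, fderiv ℝ v x (Literature.Analysis.FluidPDE.curl v x)⟫_ℝ| ≤ κ * M * Real.sqrt (∫ x, ‖Literature.Analysis.FluidPDE.curl v x‖ ^ 2) * Real.sqrt (∫ x, Literature.Analysis.FluidPDE.frobeniusNormSq (fderiv ℝ (Literature.Analysis.FluidPDE.curl v) x)))} := le_of_lt (lt_trans (by norm_num) sharpDepletion_gt)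
    have hle : sInf {κ : ℝ | (∀ (v : EuclideanSpace ℝ (Fin 3) → EuclideanSpace ℝ (Fin 3)) (M B : ℝ), ContDiff ℝ (⊤ : ℕ∞) v → Literature.Analysis.FluidPDE.VectorCalculus.IsDivFree v → (∀ x, ‖v x‖ ≤ M) → (∀ x, ‖fderiv ℝ v x‖ ≤ B) → (∫⁻ x, ‖iteratedFDeriv ℝ 0 v x‖ₑ ^ 2 < ⊤) → (∫⁻ x, ‖iteratedFDeriv ℝ 1 v x‖ₑ ^ 2 < ⊤) → (∫⁻ x, ‖iteratedFDeriv ℝ 2 v x‖ₑ ^ 2 < ⊤) → |∫ x, ⟪Literature.Analysis.FluidPDE.curl v x, fderiv ℝ v x (Literature.Analysis.FluidPDE.curl v x)⟫_ℝ| ≤ κ * M * Real.sqrt (∫ x, ‖Literature.Analysis.FluidPDE.curl v x‖ ^ 2) * Real.sqrt (∫ x, Literature.Analysis.FluidPDE.frobeniusNormSq (fderiv ℝ (Literature.Analysis.FluidPDE.curl v) x)))} ≤ κ := sharpDepletion_le hκ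
    have hlog : 0 ≤ Real.log (T / (T - t)) :=
      Real.log_nonneg ((one_le_div (sub_pos.2 ht.2)).2 (by linarith [ht.1]))
    have hsq : (θ * sInf {κ : ℝ | (∀ (v : EuclideanSpace ℝ (Fin 3) → EuclideanSpace ℝ (Fin 3)) (M B : ℝ), ContDiff ℝ (⊤ : ℕ∞) v → Literature.Analysis.FluidPDE.VectorCalculus.IsDivFree v → (∀ x, ‖v x‖ ≤ M) → (∀ x, ‖fderiv ℝ v x‖ ≤ B) → (∫⁻ x, ‖iteratedFDeriv ℝ 0 v x‖ₑ ^ 2 < ⊤) → (∫⁻ x, ‖iteratedFDeriv ℝ 1 v x‖ₑ ^ 2 < ⊤) → (∫⁻ x, ‖iteratedFDeriv ℝ 2 v x‖ₑ ^ 2 < ⊤) → |∫ x, ⟪Literature.Analysis.FluidPDE.curl v x, fderiv ℝ v x (Literature.Analysis.FluidPDE.curl v x)⟫_ℝ| ≤ κ * M * Real.sqrt (∫ x, ‖Literature.Analysis.FluidPDE.curl v x‖ ^ 2) * Real.sqrt (∫ x, Literature.Analysis.FluidPDE.frobeniusNormSq (fderiv ℝ (Literature.Analysis.FluidPDE.curl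 v) x)))}) ^ 2 ≤ (θ * κ) ^ 2 :=
      pow_le_pow_left₀ (mul_nonneg hθ0 hs0) (mul_le_mul_of_nonneg_left hle hθ0) 2
    linarith [mul_le_mul_of_nonneg_right hsq hlog]

end Summit.NavierStokesRegularity.NavierStokesRegularity.Theorems

end
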